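import Mathlib
import Summits.AtomisticToContinuum.HydrodynamicLimit.Theorems.ImplosionDichotomyDenseExcursionSonicCentreContentBulkAlgebra
import Summits.AtomisticToContinuum.HydrodynamicLimit.Theorems.ImplosionDichotomyDenseExcursionSonicCentreContentBulkBootstrap
import Summits.AtomisticToContinuum.HydrodynamicLimit.Theorems.ImplosionDichotomyDenseExcursionSonicCentreContentGaugeA
import Summits.AtomisticToContinuum.HydrodynamicLimit.Theorems.ImplosionDichotomyDenseExcursionSonicCentreContentInnerMain
import Summits.AtomisticToContinuum.HydrodynamicLimit.Theorems.ImplosionDichotomyDenseExcursionSonicCentreContentRealThree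
import Summits.AtomisticToContinuum.HydrodynamicLimit.Theorems.ImplosionDichotomyDenseExcursionSonicCentreContentGlue

/-!
# The bulk transport of the acoustic amplitude ratio and the stub `stub_centreContent`
# (crux `DenseExcursion`, line `sonic-cavity-renewal`, skeleton v7, stub `stub_centreContent`)

Proof file (`--supports stmt-AtomisticToContinuum-12586`, line lead a2, stub-worker B for `stub_centreContent`).

`bulk_ratio_of_tubeB` (registered helper = the v6 sub-stub `bulk_ratio_of_tube` with the bulk clause `CavityTubeBulk` threaded):
for a smooth radial mode of a monatomic tube profile with `−1/4 < Re Λ ≤ 3`, `|Im Λ| > boxTop = 1000`, the inner standing wave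
`‖m‖ ≤ 2‖p‖` at `log(1/100)` is transported along the bulk `[log(1/100), −7/10]` to `‖m(x_m)‖ ≤ 140‖p(x_m)‖`
(`p = ŵ + 3ŝ`, `m = ŵ − 3ŝ`; the proof delivers `80`). Assembly: the `+` gauge `θ = ∫(Λ − b₊₊)/c₊` and the primitive `Q = ∫ q`
by the fundamental theorem of calculus (integrands continuous on `x < 0`, where `c₊ > 0 > c₋`), `u = e^{−θ}p`, `w = e^{−θ}m` obey
the triangular-interaction system of `mode_levinson_form_plus`; the pointwise data of `bulk_levinson_point`; the growth majorant
`𝔊 = (77/20)eˣ + (5/3)e^{3x} + (12/5)e^{5x}` of `Re q` (`Re Q − 𝔊` is antitone), dominated linearly on the bulk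
(`bulkGrowth_linear`) with total `e^{𝔊(b) − 𝔊(a)} ≤ e^{2.17} ≤ 9`; and the abstract bootstrap `levinson_bulk_bootstrap`.
Then `stub_centreContent` follows verbatim as the landed reduction `centreContent_of_tube_of_bulk_ratio`
(`realBound_three`, `centre_inner_standing_wave`, `centreContent_of_bulk_ratio`). Sources: Coppel 1965 Ch. IV (Levinson);
no citation is load-bearing.
-/

noncomputable section

open Set Filter
open scoped Topology ContDiff

namespace Summit.AtomisticToContinuum.HydrodynamicLimit.Theorems.SonicCavityRenewal

open Summit.AtomisticToContinuum.HydrodynamicLimit.Theorems.R2OneModeTwoConditions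

/-! ## Numerics of the bulk interval `[log(1/100), −7/10]` -/

/-- `2 ≤ e^{7/10}` (four Taylor terms). [folklore] -/
theorem two_le_exp_seven_tenths : (2 : ℝ) ≤ Real.exp (7 / 10) := by
  have h := Real.sum_le_exp_of_nonneg (show (0 : ℝ) ≤ 7 / 10 by norm_num) 4
  simp only [Finset.sum_range_succ, Finset.sum_range_zero, Nat.factorial] at h
  norm_num at h
  linarith

/-- `e^{−7/10} ≤ 1/2`. [folklore] -/
theorem exp_neg_seven_tenths_le : Real.exp (-(7 / 10)) ≤ 1 / 2 := by
  rw [Real.exp_neg, ← one_div, div_le_div_iff₀ (Real.exp_pos _) (by norm_num)]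
  linarith [two_le_exp_seven_tenths]

/-- `log 100 ≤ 47/10` (nine Taylor terms of `e^{4.7} ≥ 104`). [folklore] -/
theorem log_hundred_le : Real.log 100 ≤ 47 / 10 := by
  rw [Real.log_le_iff_le_exp (by norm_num)]
  have h := Real.sum_le_exp_of_nonneg (show (0 : ℝ) ≤ 47 / 10 by norm_num) 9
  simp only [Finset.sum_range_succ, Finset.sum_range_zero, Nat.factorial] at h
  norm_num at h
  linarith

/-- `3 ≤ log 100` (`e³ < 2.72³ < 100`). [folklore] -/
theorem three_le_log_hundred : (3 : ℝ) ≤ Real.log 100 := by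
  rw [Real.le_log_iff_exp_le (by norm_num)]
  have h1 := Real.exp_one_lt_d9
  have h0 := Real.exp_pos (1 : ℝ)
  have e : Real.exp 3 = Real.exp 1 ^ 3 := by
    rw [show (3 : ℝ) = ((3 : ℕ) : ℝ) * 1 by norm_num, Real.exp_nat_mul]
  rw [e]
  nlinarith [mul_pos h0 h0]

/-- `e^{217/100} ≤ 9` (`e² < 7.3891`, `e^{0.17} < 100/83`). [folklore] -/
theorem exp_217_le_nine : Real.exp (217 / 100) ≤ 9 := by
  have h1 := Real.exp_one_lt_d9
  have h0 := Real.exp_pos (1 : ℝ)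
  have h2 : Real.exp (17 / 100) < 1 / (1 - 17 / 100) :=
    Real.exp_bound_div_one_sub_of_interval' (by norm_num) (by norm_num)
  have e : Real.exp (217 / 100) = Real.exp 1 * Real.exp 1 * Real.exp (17 / 100) := by
    rw [← Real.exp_add, ← Real.exp_add]; norm_num
  rw [e]
  have h3 : Real.exp 1 * Real.exp 1 < 2.7182818286 ^ 2 := by nlinarith
  have h4 : Real.exp 1 * Real.exp 1 * Real.exp (17 / 100) < 2.7182818286 ^ 2 * (1 / (1 - 17 / 100)) :=
    mul_lt_mul'' h3 h2 (by positivity) (by positivity)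
  norm_num at h4
  linarith

/-! ## The growth majorant `𝔊 = (77/20)eˣ + (5/3)e^{3x} + (12/5)e^{5x}` -/

/-- `𝔊′ = 𝔤 = (77/20)eˣ + 5e^{3x} + 12e^{5x}`. [folklore] -/
theorem hasDerivAt_bulkGrowth (x : ℝ) :
    HasDerivAt (fun y => 77 / 20 * Real.exp y + 5 / 3 * Real.exp y ^ 3 + 12 / 5 * Real.exp y ^ 5)
      (77 / 20 * Real.exp x + 5 * Real.exp x ^ 3 + 12 * Real.exp x ^ 5) x := by
  have h := Real.hasDerivAt_exp x
  have key := ((h.const_mul (77 / 20 : ℝ)).add ((h.pow 3).const_mul (5 / 3 : ℝ))).add ((h.pow 5).const_mul (12 / 5 : ℝ))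
  refine key.congr_deriv ?_
  push_cast
  ring

/-- `𝔊` is monotone. [folklore] -/
theorem bulkGrowth_mono {s t : ℝ} (h : s ≤ t) :
    77 / 20 * Real.exp s + 5 / 3 * Real.exp s ^ 3 + 12 / 5 * Real.exp s ^ 5 ≤
      77 / 20 * Real.exp t + 5 / 3 * Real.exp t ^ 3 + 12 / 5 * Real.exp t ^ 5 := by
  have := Real.exp_le_exp.2 h
  gcongr

/-- `𝔤` is monotone. [folklore] -/
theorem bulkGrowthRate_mono {s t : ℝ} (h : s ≤ t) :
    77 / 20 * Real.exp s + 5 * Real.exp s ^ 3 + 12 * Real.exp s ^ 5 ≤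
      77 / 20 * Real.exp t + 5 * Real.exp t ^ 3 + 12 * Real.exp t ^ 5 := by
  have := Real.exp_le_exp.2 h
  gcongr

/-- The total growth over the bulk: `𝔊(−7/10) − 𝔊(log(1/100)) ≤ 217/100` (`e^{−7/10} ≤ 1/2`). [folklore] -/
theorem bulkGrowth_total_le :
    (77 / 20 * Real.exp (-(7 / 10)) + 5 / 3 * Real.exp (-(7 / 10)) ^ 3 + 12 / 5 * Real.exp (-(7 / 10)) ^ 5) -
      (77 / 20 * Real.exp (Real.log (1 / 100)) + 5 / 3 * Real.exp (Real.log (1 / 100)) ^ 3 +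
        12 / 5 * Real.exp (Real.log (1 / 100)) ^ 5) ≤ 217 / 100 := by
  rw [Real.exp_log (by norm_num)]
  have hb := exp_neg_seven_tenths_le
  have hb0 := Real.exp_pos (-(7 / 10) : ℝ)
  have h3 : Real.exp (-(7 / 10)) ^ 3 ≤ (1 / 2) ^ 3 := pow_le_pow_left₀ hb0.le hb 3
  have h5 : Real.exp (-(7 / 10)) ^ 5 ≤ (1 / 2) ^ 5 := pow_le_pow_left₀ hb0.le hb 5
  norm_num at h3 h5 ⊢
  linarith

/-- **`bulkGrowth_linear`: LINEAR DOMINATION OF THE GROWTH MAJORANT ON THE BULK.** For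
`log(1/100) ≤ x ≤ −7/10`: `𝔊(x) − 𝔊(log(1/100)) ≤ x − log(1/100)` (if `𝔤(x) ≤ 1`, `𝔊 − id` is antitone on `[a, x]`; otherwise it is
monotone on `[x, b]` and `𝔊(b) − 𝔊(a) ≤ 2.17 ≤ 2.3 ≤ b − a`). It makes the Levinson weight `e^{𝔊 − 𝔊(a)}` at most the linear
weight `e^{x − a} = 100eˣ`, whose products with `e^{−x}`-envelopes have elementary primitives. [folklore] -/
theorem bulkGrowth_linear : ∀ x : ℝ, Real.log (1 / 100) ≤ x → x ≤ -(7 / 10) → (77 / 20 * Real.exp x + 5 / 3 * Real.exp x ^ 3 + 12 / 5 * Real.exp x ^ 5) - (77 / 20 * Real.exp (Real.log (1 / 100)) + 5 / 3 * Real.exp (Real.log (1 / 100)) ^ 3 + 12 / 5 * Real.exp (Real.log (1 / 100)) ^ 5) ≤ x - Real.log (1 / 100) := by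
  intro x hxa hxb
  have htot := bulkGrowth_total_le
  set a : ℝ := Real.log (1 / 100) with ha
  set 𝔊 : ℝ → ℝ := fun y => 77 / 20 * Real.exp y + 5 / 3 * Real.exp y ^ 3 + 12 / 5 * Real.exp y ^ 5 with h𝔊
  set 𝔤 : ℝ → ℝ := fun y => 77 / 20 * Real.exp y + 5 * Real.exp y ^ 3 + 12 * Real.exp y ^ 5 with h𝔤
  have hd : ∀ y : ℝ, HasDerivAt (fun t => 𝔊 t - t) (𝔤 y - 1) y := fun y =>
    (hasDerivAt_bulkGrowth y).sub (hasDerivAt_id y)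
  have hav : a = -Real.log 100 := by rw [ha, one_div, Real.log_inv]
  have hba : 23 / 10 ≤ -(7 / 10) - a := by rw [hav]; linarith [three_le_log_hundred]
  change 𝔊 x - 𝔊 a ≤ x - a
  by_cases hgx : 𝔤 x ≤ 1
  · have hanti : AntitoneOn (fun t => 𝔊 t - t) (Icc a x) :=
      antitoneOn_of_hasDerivWithinAt_nonpos (convex_Icc a x) (fun y _ => (hd y).continuousAt.continuousWithinAt)
        (fun y _ => (hd y).hasDerivWithinAt) (fun y hy => by
          rw [interior_Icc] at hy
          have := bulkGrowthRate_mono hy.2.le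
          change 𝔤 y ≤ 𝔤 x at this
          linarith)
    have key := hanti (left_mem_Icc.2 hxa) (right_mem_Icc.2 hxa) hxa
    simp only at key
    linarith
  · have hgx' : 1 < 𝔤 x := lt_of_not_ge hgx
    have hmono : MonotoneOn (fun t => 𝔊 t - t) (Icc x (-(7 / 10))) :=
      monotoneOn_of_hasDerivWithinAt_nonneg (convex_Icc x _) (fun y _ => (hd y).continuousAt.continuousWithinAt)
        (fun y _ => (hd y).hasDerivWithinAt) (fun y hy => by
          rw [interior_Icc] at hy
          have := bulkGrowthRate_mono hy.1.le
          change 𝔤 x ≤ 𝔤 y at this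
          linarith)
    have key := hmono (left_mem_Icc.2 hxb) (right_mem_Icc.2 hxb) hxb
    simp only at key
    change 𝔊 (-(7 / 10)) - 𝔊 a ≤ 217 / 100 at htot
    linarith

/-! ## The bulk transport -/

/-- **Registered helper `bulk_ratio_of_tubeB`: THE BULK TRANSPORT OF THE ACOUSTIC AMPLITUDE RATIO** (the v6 sub-stub
`bulk_ratio_of_tube` with the bulk clause `CavityTubeBulk` threaded). For a smooth radial mode of a monatomic tube profile on the
pinned window with `−1/4 < Re Λ ≤ 3`, `|Im Λ| > boxTop`: `‖m‖ ≤ 2‖p‖` at `log(1/100)` implies `‖m‖ ≤ 140‖p‖` at `matchPoint`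
(`+` gauge by FTC, `mode_levinson_form_plus`, `bulk_levinson_point`, `bulkGrowth_linear`, `levinson_bulk_bootstrap`; the proof gives
`80`). [folklore] -/
theorem bulk_ratio_of_tubeB : ∀ (r : ℝ) (W S : ℝ → ℝ) (Λ : ℂ) (ŵ ŝ : ℝ → ℂ), 17307 / 15625 ≤ r → r ≤ 89409 / 80000 → IsMonatomicProfile r W S → CavityTube r W S → CavityTubeBulk r W S → IsSmoothRadialMode r W S Λ ŵ ŝ → -(1 / 4 : ℝ) < Λ.re → Λ.re ≤ 3 → boxTop < |Λ.im| → ‖ŵ (Real.log (1 / 100)) - 3 * ŝ (Real.log (1 / 100))‖ ≤ 2 * ‖ŵ (Real.log (1 / 100)) + 3 * ŝ (Real.log (1 / 100))‖ → ‖ŵ matchPoint - 3 * ŝ matchPoint‖ ≤ 140 * ‖ŵ matchPoint + 3 * ŝ matchPoint‖ := by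
  intro r W S Λ ŵ ŝ _ _ hP hT hB hmode hre _ him hinner
  have hPc := hP
  obtain ⟨-, -, hW, hS, -, -⟩ := hPc
  obtain ⟨⟨hŵ, hŝ, -⟩, -, hmodes⟩ := hmode
  have htop : (1000 : ℝ) < |Λ.im| := by simpa [boxTop] using him
  set a : ℝ := Real.log (1 / 100) with ha
  set b : ℝ := matchPoint with hb
  have hbv : b = -(7 / 10) := rfl
  have hav : a = -Real.log 100 := by rw [ha, one_div, Real.log_inv]
  have ha0 : a < 0 := by rw [hav]; linarith [three_le_log_hundred]
  have hb0 : b < 0 := by rw [hbv]; norm_num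
  have hab : a ≤ b := by rw [hav, hbv]; linarith [three_le_log_hundred]
  -- the coefficient functions of the `+` gauge
  set α : ℝ → ℂ := fun y => -((bulkBpm W S y : ℝ) : ℂ) / ((bulkCp W S y : ℝ) : ℂ) with hαd
  set β : ℝ → ℂ := fun y => -((bulkBmp W S y : ℝ) : ℂ) / ((bulkCm W S y : ℝ) : ℂ) with hβd
  set q : ℝ → ℂ := fun y => (Λ - ((bulkBmm r W S y : ℝ) : ℂ)) / ((bulkCm W S y : ℝ) : ℂ) -
    (Λ - ((bulkBpp r W S y : ℝ) : ℂ)) / ((bulkCp W S y : ℝ) : ℂ) with hqd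
  set f : ℝ → ℂ := fun y => (Λ - ((bulkBpp r W S y : ℝ) : ℂ)) / ((bulkCp W S y : ℝ) : ℂ) with hfd
  -- continuity of the integrands on `x < 0`
  obtain ⟨hCp, hCm, -, -, hBpp, hBmm⟩ := differentiable_bulk hW hS r
  have hne : ∀ y ∈ Iio (0 : ℝ), ((bulkCp W S y : ℝ) : ℂ) ≠ 0 ∧ ((bulkCm W S y : ℝ) : ℂ) ≠ 0 := fun y hy => by
    obtain ⟨h1, h2, -⟩ := bulk_signs hP hT (show y < 0 from hy)
    exact ⟨Complex.ofReal_ne_zero.2 h1.ne', Complex.ofReal_ne_zero.2 h2.ne⟩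
  have hc1 : Continuous fun y => (Λ - ((bulkBpp r W S y : ℝ) : ℂ)) :=
    continuous_const.sub (Complex.continuous_ofReal.comp hBpp.continuous)
  have hc2 : Continuous fun y => (Λ - ((bulkBmm r W S y : ℝ) : ℂ)) :=
    continuous_const.sub (Complex.continuous_ofReal.comp hBmm.continuous)
  have hc3 : Continuous fun y => ((bulkCp W S y : ℝ) : ℂ) := Complex.continuous_ofReal.comp hCp.continuous
  have hc4 : Continuous fun y => ((bulkCm W S y : ℝ) : ℂ) := Complex.continuous_ofReal.comp hCm.continuous
  have hfc : ContinuousOn f (Iio 0) := hc1.continuousOn.div hc3.continuousOn (fun y hy => (hne y hy).1)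
  have hqc : ContinuousOn q (Iio 0) :=
    (hc2.continuousOn.div hc4.continuousOn (fun y hy => (hne y hy).2)).sub
      (hc1.continuousOn.div hc3.continuousOn (fun y hy => (hne y hy).1))
  -- the phase `θ = ∫ (Λ - b₊₊)/c₊` and the primitive `Q = ∫ q` (fundamental theorem of calculus)
  have hFTC : ∀ {g : ℝ → ℂ}, ContinuousOn g (Iio 0) → ∀ x ∈ Iio (0 : ℝ),
      HasDerivAt (fun u => ∫ t in a..u, g t) (g x) x := by
    intro g hg x hx
    have hsub : uIcc a x ⊆ Iio 0 := fun t ht => lt_of_le_of_lt ht.2 (max_lt ha0 hx)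
    exact intervalIntegral.integral_hasDerivAt_right ((hg.mono hsub).intervalIntegrable)
      (hg.stronglyMeasurableAtFilter isOpen_Iio x hx) ((hg x hx).continuousAt (isOpen_Iio.mem_nhds hx))
  set θ : ℝ → ℂ := fun u => ∫ t in a..u, f t with hθd
  set Q : ℝ → ℂ := fun u => ∫ t in a..u, q t with hQd
  have hθ : ∀ x ∈ Iio (0 : ℝ), HasDerivAt θ (f x) x := fun x hx => hFTC hfc x hx
  have hQ : ∀ x ∈ Icc a b, HasDerivAt Q (q x) x := fun x hx => hFTC hqc x (lt_of_le_of_lt hx.2 hb0)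
  -- the gauged amplitudes `u = e^{-θ} p`, `w = e^{-θ} m`
  set u : ℝ → ℂ := fun y => Complex.exp (-θ y) * (ŵ y + 3 * ŝ y) with hud
  set w : ℝ → ℂ := fun y => Complex.exp (-θ y) * (ŵ y - 3 * ŝ y) with hwd
  have hŵd : ∀ x, DifferentiableAt ℝ ŵ x := fun x => (hŵ.differentiable (by simp)) x
  have hŝd : ∀ x, DifferentiableAt ℝ ŝ x := fun x => (hŝ.differentiable (by simp)) x
  have hlev : ∀ x ∈ Icc a b, HasDerivAt u (α x * w x) x ∧ HasDerivAt w (q x * w x + β x * u x) x := by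
    intro x hx
    have hx0 : x < 0 := lt_of_le_of_lt hx.2 hb0
    obtain ⟨h1, h2, -⟩ := bulk_signs hP hT hx0
    exact mode_levinson_form_plus r W S Λ ŵ ŝ θ x (hŵd x) (hŝd x) (hmodes x) h1.ne' h2.ne (hθ x hx0)
  have hu : ∀ x ∈ Icc a b, HasDerivAt u (α x * w x) x := fun x hx => (hlev x hx).1
  have hw : ∀ x ∈ Icc a b, HasDerivAt w (q x * w x + β x * u x) x := fun x hx => (hlev x hx).2
  -- the pointwise Levinson data
  have hpt := fun x (hx : x ∈ Icc a b) => bulk_levinson_point r W S Λ x hP hT hB hx.1 hx.2 hre htop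
  have hq : ∀ x ∈ Icc a b, q x ≠ 0 := fun x hx => (hpt x hx).1.1
  have hgrowth : ∀ x ∈ Icc a b, (q x).re ≤ 77 / 20 * Real.exp x + 5 * Real.exp x ^ 3 + 12 * Real.exp x ^ 5 :=
    fun x hx => (hpt x hx).1.2
  have hε₁ : ∀ x ∈ Icc a b, ‖β x / q x‖ ≤ Real.exp (-x) / 2000 := fun x hx => (hpt x hx).2.1.1
  have hφ₃ : ∀ x ∈ Icc a b, ‖β x / q x‖ * ‖α x‖ ≤ 53 / 100000 * Real.exp (-x) := fun x hx => (hpt x hx).2.1.2.1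
  have hψ₃ : ∀ x ∈ Icc a b, ‖α x / q x‖ * ‖β x‖ ≤ 53 / 100000 * Real.exp (-x) := fun x hx => (hpt x hx).2.1.2.2.1
  have hαq : ∀ x ∈ Icc a b, ‖α x / q x‖ ≤ (51 / 100 * Real.exp (-x) + 61 / 100) / 1000 :=
    fun x hx => (hpt x hx).2.1.2.2.2
  have hρ : ∀ x ∈ Icc a b, HasDerivAt (fun y => β y / q y) (deriv (fun y => β y / q y) x) x :=
    fun x hx => (hpt x hx).2.2.1.1.hasDerivAt
  have hφ₂ : ∀ x ∈ Icc a b, ‖deriv (fun y => β y / q y) x‖ ≤ 13 / 25000 * Real.exp (-x) :=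
    fun x hx => (hpt x hx).2.2.1.2
  have hσ : ∀ x ∈ Icc a b, HasDerivAt (fun y => α y / q y) (deriv (fun y => α y / q y) x) x :=
    fun x hx => (hpt x hx).2.2.2.1.hasDerivAt
  have hψ₂ : ∀ x ∈ Icc a b, ‖deriv (fun y => α y / q y) x‖ * Real.exp x ≤ 511 / 1000000 :=
    fun x hx => (hpt x hx).2.2.2.2
  -- the growth majorant
  set 𝔊 : ℝ → ℝ := fun y => 77 / 20 * Real.exp y + 5 / 3 * Real.exp y ^ 3 + 12 / 5 * Real.exp y ^ 5 with h𝔊d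
  have h𝔊a : ∀ x ∈ Icc a b, 𝔊 a ≤ 𝔊 x := fun x hx => bulkGrowth_mono hx.1
  have h𝔊c : ContinuousOn 𝔊 (Icc a b) := fun y _ => (hasDerivAt_bulkGrowth y).continuousAt.continuousWithinAt
  have hD : ∀ t ∈ Icc a b, HasDerivAt (fun s => (Q s).re - 𝔊 s)
      ((q t).re - (77 / 20 * Real.exp t + 5 * Real.exp t ^ 3 + 12 * Real.exp t ^ 5)) t := fun t ht => by
    have h1 : HasDerivAt (fun s => (Q s).re) (q t).re t := by
      simpa [Function.comp_def] using Complex.reCLM.hasFDerivAt.comp_hasDerivAt t (hQ t ht)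
    exact h1.sub (hasDerivAt_bulkGrowth t)
  have hanti : AntitoneOn (fun s => (Q s).re - 𝔊 s) (Icc a b) :=
    antitoneOn_of_hasDerivWithinAt_nonpos (convex_Icc a b) (fun t ht => (hD t ht).continuousAt.continuousWithinAt)
      (fun t ht => (hD t (interior_subset ht)).hasDerivWithinAt)
      (fun t ht => by linarith [hgrowth t (interior_subset ht)])
  have h𝔊 : ∀ x ∈ Icc a b, ∀ y ∈ Icc a x, (Q x - Q y).re ≤ 𝔊 x - 𝔊 y := by
    intro x hx y hy
    have key := hanti ⟨hy.1, hy.2.trans hx.2⟩ hx hy.2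
    simp only at key
    rw [Complex.sub_re]
    linarith
  have h𝔊lin : ∀ x ∈ Icc a b, 𝔊 x - 𝔊 a ≤ x - a := fun x hx => bulkGrowth_linear x hx.1 hx.2
  have h𝔊b : Real.exp (𝔊 b - 𝔊 a) ≤ 9 := (Real.exp_le_exp.2 bulkGrowth_total_le).trans exp_217_le_nine
  -- the numerics of the endpoints
  have hea : Real.exp (-a) = 100 := by rw [hav, neg_neg, Real.exp_log (by norm_num)]
  have heb1 : Real.exp (-b) ≤ 219 / 100 := by rw [hbv, neg_neg]; exact exp_seven_tenths_le
  have heb2 : Real.exp b ≤ 1 / 2 := exp_neg_seven_tenths_le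
  have hba : b - a ≤ 4 := by rw [hav, hbv]; linarith [log_hundred_le]
  -- the inner standing wave in the gauge
  have hwa : ‖w a‖ ≤ 2 * ‖u a‖ := by
    change ‖Complex.exp (-θ a) * (ŵ a - 3 * ŝ a)‖ ≤ 2 * ‖Complex.exp (-θ a) * (ŵ a + 3 * ŝ a)‖
    rw [norm_mul, norm_mul]
    calc ‖Complex.exp (-θ a)‖ * ‖ŵ a - 3 * ŝ a‖ ≤ ‖Complex.exp (-θ a)‖ * (2 * ‖ŵ a + 3 * ŝ a‖) :=
          mul_le_mul_of_nonneg_left hinner (norm_nonneg _)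
      _ = 2 * (‖Complex.exp (-θ a)‖ * ‖ŵ a + 3 * ŝ a‖) := by ring
  -- THE BOOTSTRAP
  have key := levinson_bulk_bootstrap a b u w α β q Q (fun x => deriv (fun y => β y / q y) x)
    (fun x => deriv (fun y => α y / q y) x) 𝔊 hab hu hw hQ hq h𝔊 h𝔊a h𝔊c h𝔊lin h𝔊b hρ hσ hε₁ hφ₂ hφ₃ hψ₂ hψ₃ hαq
    hea heb1 heb2 hba hwa
  -- undo the gauge
  have hee : Complex.exp (θ b) * Complex.exp (-θ b) = 1 := by rw [← Complex.exp_add, add_neg_cancel, Complex.exp_zero]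
  have e1 : ŵ b - 3 * ŝ b = Complex.exp (θ b) * w b := by
    change ŵ b - 3 * ŝ b = Complex.exp (θ b) * (Complex.exp (-θ b) * (ŵ b - 3 * ŝ b))
    rw [← mul_assoc, hee, one_mul]
  have e2 : ŵ b + 3 * ŝ b = Complex.exp (θ b) * u b := by
    change ŵ b + 3 * ŝ b = Complex.exp (θ b) * (Complex.exp (-θ b) * (ŵ b + 3 * ŝ b))
    rw [← mul_assoc, hee, one_mul]
  have hfin : ∀ e wb ub : ℂ, ‖wb‖ ≤ 80 * ‖ub‖ → ‖e * wb‖ ≤ 140 * ‖e * ub‖ := by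
    intro e wb ub h
    rw [norm_mul, norm_mul]
    have h1 : ‖e‖ * ‖wb‖ ≤ ‖e‖ * (80 * ‖ub‖) := mul_le_mul_of_nonneg_left h (norm_nonneg e)
    nlinarith [mul_nonneg (norm_nonneg e) (norm_nonneg ub)]
  rw [e1, e2]
  exact hfin _ _ _ key

/-! ## The stub -/

/-- **`stub_centreContent` (skeleton v7 of crux `DenseExcursion`, line `sonic-cavity-renewal`): THE CENTRE HALF OF
`|Im Λ|`-CONFINEMENT.** For the pinned window `17307/15625 ≤ r ≤ 697/625`, a monatomic profile satisfying the profile equations,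
the cavity tube and its bulk envelopes has `CentreContent r W S`: every smooth radial mode with `−1/4 < Re Λ ≤ boxSide`,
`|Im Λ| > boxTop` has `‖m(x_m)‖ ≤ 250‖D‖` at the matching point. Proof = the landed reduction `centreContent_of_tube_of_bulk_ratio`
with the bulk hypothesis threaded: `Re Λ ≤ 3` (`realBound_three`), `‖Λ‖ ≥ |Im Λ| > 1000`, the inner standing wave
(`centre_inner_standing_wave`), the bulk transport (`bulk_ratio_of_tubeB`), and the glue (`centreContent_of_bulk_ratio`). -/
theorem stub_centreContent : ∀ (r : ℝ) (W S : ℝ → ℝ), (17307 / 15625 : ℝ) ≤ r → r ≤ 697 / 625 → IsMonatomicProfile r W S → OrigProfileEqs r W S → CavityTube r W S → CavityTubeBulk r W S → CentreContent r W S := by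
  intro r W S hr₁ hr₂ hP _hE hT hB
  have hr₂' : r ≤ 89409 / 80000 := hr₂.trans (by norm_num)
  refine centreContent_of_bulk_ratio r W S hP hT (fun Λ ŵ ŝ hm hre _ him => ?_)
  have h3 : Λ.re ≤ 3 := realBound_three r W S Λ ŵ ŝ hP hT hm
  have htop : (1000 : ℝ) < |Λ.im| := by simpa [boxTop] using him
  have hL : 1000 ≤ ‖Λ‖ := le_trans htop.le (Complex.abs_im_le_norm Λ)
  exact bulk_ratio_of_tubeB r W S Λ ŵ ŝ hr₁ hr₂' hP hT hB hm hre h3 him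
    (centre_inner_standing_wave r W S Λ ŵ ŝ hr₁ hr₂' hP hT hm hre h3 hL)

end Summit.AtomisticToContinuum.HydrodynamicLimit.Theorems.SonicCavityRenewal

end
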